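import Literature.AlgebraicGeometry.Motives.AbelianVarietyEquivariantSimpleFactorsUnique
import Mathlib.Algebra.MonoidAlgebra.Basic
import HarnessLib

/-!
# The `G`-simple pieces are unique up to `G`-equivariant isogeny (finite group, algebraically closed field)

The finite-group form of `Motives/AbelianVarietyEquivariantSimpleFactorsUnique` (there: ring
actions `R →+* End`), obtained through the group ring `ℤ[G]` exactly as the existence theorem
`Motives/AbelianVarietyEquivariantQuasiDecompositionFiniteGroup` was obtained from the ring engine:
a `G`-action `ρ : G →* End X` is a `ℤ[G]`-action (`MonoidAlgebra.lift`), `G`- and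
`ℤ[G]`-equivariance agree (additivity), `G`-simple is `ℤ[G]`-simple.  Over an ALGEBRAICALLY CLOSED
field, for a group `G` (finiteness is not needed for uniqueness):

* `AbelianVariety.comp_eq_comp_monoidAlgebra_of_forall` — equivariance under `G` extends to
  equivariance under `ℤ[G]`;
* `AbelianVariety.exists_equivariantlyIsogenous_piece_of_simpleFor_group` — **each `G`-simple
  piece of positive dimension of a `G`-equivariant decomposition up to isogeny of `(X, ρ)` is
  `G`-equivariantly isogenous to a piece of any other such decomposition (of a `G`-isogenous
  `(X', ρ')`)**; `AbelianVariety.card_equivariantlyIsogenous_eq_of_simpleFor_group` — the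
  multiplicities agree.  With the existence theorem (`exists_equivariant_quasiDecomposition_of_fintype`)
  this is Lange–Rodríguez's uniqueness of the decomposition of an abelian variety with `G`-action
  into `G`-simple abelian subvarieties (there over `ℂ`), i.e. Krull–Schmidt for abelian varieties
  with a group of operators.

Everything is proved; no definition, no named fact (D-0026).

## References

* H. Lange, R. E. Rodríguez, *Decomposition of Jacobians by Prym Varieties*, LNM 2310 (2022),
  §§2.8–2.9 (isotypical decomposition and `G`-simple pieces, uniqueness up to `G`-isogeny).
  [LangeRodriguez2022]
* J. S. Milne, *Abelian Varieties*, in Cornell–Silverman (eds.), *Arithmetic Geometry* (1986), §12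
  p. 122. [Milne1986AbelianVarieties]
-/

noncomputable section

universe u v

open CategoryTheory CategoryTheory.Limits AlgebraicGeometry

namespace Literature.AlgebraicGeometry.Motives

namespace AbelianVariety

variable {K : Type u} [Field K] {G : Type v} [Group G]

/-- **Equivariance under `G` extends to equivariance under the group ring `ℤ[G]`**: if
`f ≫ β g = α g ≫ f` on the generators `g ∈ G` of two ring actions `α : ℤ[G] →+* End A`,
`β : ℤ[G] →+* End B`, then `f ≫ β a = α a ≫ f` for all `a ∈ ℤ[G]` (both sides are additive in
`a`). [cite: LangeRodriguez2022, §2.9] -/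
theorem comp_eq_comp_monoidAlgebra_of_forall {A B : AbelianVariety K}
    (α : MonoidAlgebra ℤ G →+* End A) (β : MonoidAlgebra ℤ G →+* End B) (f : A ⟶ B)
    (hf : ∀ g : G, f ≫ End.asHom (β (MonoidAlgebra.of ℤ G g)) =
      End.asHom (α (MonoidAlgebra.of ℤ G g)) ≫ f)
    (a : MonoidAlgebra ℤ G) : f ≫ End.asHom (β a) = End.asHom (α a) ≫ f := by
  induction a using MonoidAlgebra.induction_on with
  | hM g => exact hf g
  | hadd x y hx hy =>
    rw [map_add, map_add]
    change f ≫ (End.asHom (β x) + End.asHom (β y)) = (End.asHom (α x) + End.asHom (α y)) ≫ f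
    rw [Preadditive.comp_add, Preadditive.add_comp, hx, hy]
  | hsmul r x hx =>
    rw [map_zsmul, map_zsmul]
    change f ≫ (r • End.asHom (β x)) = (r • End.asHom (α x)) ≫ f
    rw [Preadditive.comp_zsmul, Preadditive.zsmul_comp, hx]

variable [IsAlgClosed K] {X : AbelianVariety K} {I : Type} [Fintype I] {S : I → AbelianVariety K}
  (ι : ∀ i, S i ⟶ X) (π : ∀ i, X ⟶ S i) {N : ℕ}

/-- **Each `G`-simple piece is determined up to `G`-equivariant isogeny (algebraically closed
ground field).** For `G`-equivariant decompositions up to isogeny `X ~ ⊕ Sᵢ` of `(X, ρ)` and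
`X' ~ ⊕ Tⱼ` of `(X', ρ')` into `G`-SIMPLE pieces `(Sᵢ, χᵢ)`, `(Tⱼ, τⱼ)` and a `G`-equivariant
isogeny `u : X ⟶ X'`, every piece `S_{i₀}` of positive dimension receives a `G`-equivariant isogeny
from some `Tⱼ` — `exists_equivariantlyIsogenous_piece_of_simpleFor` for the group-ring actions
`ℤ[G] →+* End`. [cite: LangeRodriguez2022, §§2.8–2.9] [cite: Milne1986AbelianVarieties, §12 p. 122 (PDF p. 189)] -/
theorem exists_equivariantlyIsogenous_piece_of_simpleFor_group (ρ : G →* End X)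
    (χ : ∀ i, G →* End (S i))
    (hS : ∀ i, ∀ (W : AbelianVariety K) (ω : G →* End W) (w : W ⟶ S i),
      IsClosedImmersion (Hom.toSchemeHom w) →
      (∀ g : G, w ≫ End.asHom (χ i g) = End.asHom (ω g) ≫ w) →
      0 < W.dim → W.dim < (S i).dim → False)
    (hN : 0 < N) (h1 : ∀ i, ι i ≫ π i = N • 𝟙 (S i)) (h2 : ∀ i j, i ≠ j → ι i ≫ π j = 0)
    (h3 : ∑ i, π i ≫ ι i = N • 𝟙 X)
    (hι : ∀ i (g : G), ι i ≫ End.asHom (ρ g) = End.asHom (χ i g) ≫ ι i)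
    (hπ : ∀ i (g : G), End.asHom (ρ g) ≫ π i = π i ≫ End.asHom (χ i g))
    {X' : AbelianVariety K} (ρ' : G →* End X') {J : Type} [Fintype J]
    {T : J → AbelianVariety K} (τ : ∀ j, G →* End (T j))
    (hT : ∀ j, ∀ (W : AbelianVariety K) (ω : G →* End W) (w : W ⟶ T j),
      IsClosedImmersion (Hom.toSchemeHom w) →
      (∀ g : G, w ≫ End.asHom (τ j g) = End.asHom (ω g) ≫ w) →
      0 < W.dim → W.dim < (T j).dim → False)
    (ι' : ∀ j, T j ⟶ X') (π' : ∀ j, X' ⟶ T j) {N' : ℕ} (hN' : 0 < N')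
    (h1' : ∀ j, ι' j ≫ π' j = N' • 𝟙 (T j)) (h2' : ∀ j j', j ≠ j' → ι' j ≫ π' j' = 0)
    (h3' : ∑ j, π' j ≫ ι' j = N' • 𝟙 X')
    (hι' : ∀ j (g : G), ι' j ≫ End.asHom (ρ' g) = End.asHom (τ j g) ≫ ι' j)
    (hπ' : ∀ j (g : G), End.asHom (ρ' g) ≫ π' j = π' j ≫ End.asHom (τ j g))
    {u : X ⟶ X'} (hu : IsIsogeny u) (hue : ∀ g : G, End.asHom (ρ g) ≫ u = u ≫ End.asHom (ρ' g))
    (i₀ : I) (hi₀ : 0 < (S i₀).dim) :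
    ∃ (j : J) (v : T j ⟶ S i₀), IsIsogeny v ∧
      ∀ g : G, End.asHom (τ j g) ≫ v = v ≫ End.asHom (χ i₀ g) := by
  -- group ring, restriction and extension of actions
  let ZG := MonoidAlgebra ℤ G
  let res : ∀ {A : AbelianVariety K}, (ZG →+* End A) → (G →* End A) :=
    fun φ ↦ (φ : ZG →* End _).comp (MonoidAlgebra.of ℤ G)
  let ext : ∀ {A : AbelianVariety K}, (G →* End A) → (ZG →+* End A) :=
    fun ρ ↦ (MonoidAlgebra.lift ℤ (End _) G ρ).toRingHom
  have ext_of : ∀ {A : AbelianVariety K} (ρ : G →* End A) (g : G),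
      ext ρ (MonoidAlgebra.of ℤ G g) = ρ g := fun ρ g ↦ by
    change MonoidAlgebra.lift ℤ (End _) G ρ (MonoidAlgebra.of ℤ G g) = ρ g
    exact MonoidAlgebra.lift_of ρ g
  -- `G`-equivariance on generators gives `ℤ[G]`-equivariance (both orientations)
  have hin : ∀ {A B : AbelianVariety K} (a : G →* End A) (b : G →* End B) (f : A ⟶ B),
      (∀ g : G, f ≫ End.asHom (b g) = End.asHom (a g) ≫ f) →
      ∀ x : ZG, f ≫ End.asHom (ext b x) = End.asHom (ext a x) ≫ f :=
    fun a b f hf ↦ comp_eq_comp_monoidAlgebra_of_forall (ext a) (ext b) f fun g ↦ by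
      rw [ext_of, ext_of]; exact hf g
  -- `G`-simple pieces are `ℤ[G]`-simple
  have hsimple : ∀ {A : AbelianVariety K} (a : G →* End A),
      (∀ (W : AbelianVariety K) (ω : G →* End W) (w : W ⟶ A),
        IsClosedImmersion (Hom.toSchemeHom w) →
        (∀ g : G, w ≫ End.asHom (a g) = End.asHom (ω g) ≫ w) → 0 < W.dim → W.dim < A.dim →
        False) →
      ∀ (W : AbelianVariety K) (ω : ZG →+* End W) (w : W ⟶ A),
        IsClosedImmersion (Hom.toSchemeHom w) →
        (∀ x : ZG, w ≫ End.asHom (ext a x) = End.asHom (ω x) ≫ w) → 0 < W.dim → W.dim < A.dim →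
        False :=
    fun a ha W ω w hw hwe h0 hlt ↦ ha W (res ω) w hw (fun g ↦ by rw [← ext_of a g]; exact hwe _)
      h0 hlt
  obtain ⟨j, v, hv, hve⟩ := exists_equivariantlyIsogenous_piece_of_simpleFor ι π (ext ρ)
    (fun i ↦ ext (χ i)) (fun i ↦ hsimple (χ i) (hS i)) hN h1 h2 h3
    (fun i x ↦ hin (χ i) ρ (ι i) (hι i) x)
    (fun i x ↦ (hin ρ (χ i) (π i) (fun g ↦ (hπ i g).symm) x).symm)
    (ext ρ') (fun j ↦ ext (τ j)) (fun j ↦ hsimple (τ j) (hT j)) ι' π' hN' h1' h2' h3'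
    (fun j x ↦ hin (τ j) ρ' (ι' j) (hι' j) x)
    (fun j x ↦ (hin ρ' (τ j) (π' j) (fun g ↦ (hπ' j g).symm) x).symm)
    hu (fun x ↦ (hin ρ ρ' u (fun g ↦ (hue g).symm) x).symm) i₀ hi₀
  refine ⟨j, v, hv, fun g ↦ ?_⟩
  have e := hve (MonoidAlgebra.of ℤ G g)
  rwa [ext_of, ext_of] at e

/-- **The multiplicities of the `G`-simple pieces are uniquely determined (algebraically closed
ground field)**: in the situation of `exists_equivariantlyIsogenous_piece_of_simpleFor_group`, for
any `G`-simple `(B, β)` of positive dimension, the number of `Sᵢ` admitting a `G`-equivariant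
isogeny to `B` equals the number of such `Tⱼ`. [cite: LangeRodriguez2022, §§2.8–2.9]
[cite: Milne1986AbelianVarieties, §12 p. 122 (PDF p. 189)] -/
theorem card_equivariantlyIsogenous_eq_of_simpleFor_group (ρ : G →* End X)
    (χ : ∀ i, G →* End (S i))
    (hS : ∀ i, ∀ (W : AbelianVariety K) (ω : G →* End W) (w : W ⟶ S i),
      IsClosedImmersion (Hom.toSchemeHom w) →
      (∀ g : G, w ≫ End.asHom (χ i g) = End.asHom (ω g) ≫ w) →
      0 < W.dim → W.dim < (S i).dim → False)
    (hN : 0 < N) (h1 : ∀ i, ι i ≫ π i = N • 𝟙 (S i)) (h2 : ∀ i j, i ≠ j → ι i ≫ π j = 0)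
    (h3 : ∑ i, π i ≫ ι i = N • 𝟙 X)
    (hι : ∀ i (g : G), ι i ≫ End.asHom (ρ g) = End.asHom (χ i g) ≫ ι i)
    (hπ : ∀ i (g : G), End.asHom (ρ g) ≫ π i = π i ≫ End.asHom (χ i g))
    {X' : AbelianVariety K} (ρ' : G →* End X') {J : Type} [Fintype J]
    {T : J → AbelianVariety K} (τ : ∀ j, G →* End (T j))
    (hT : ∀ j, ∀ (W : AbelianVariety K) (ω : G →* End W) (w : W ⟶ T j),
      IsClosedImmersion (Hom.toSchemeHom w) →
      (∀ g : G, w ≫ End.asHom (τ j g) = End.asHom (ω g) ≫ w) →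
      0 < W.dim → W.dim < (T j).dim → False)
    (ι' : ∀ j, T j ⟶ X') (π' : ∀ j, X' ⟶ T j) {N' : ℕ} (hN' : 0 < N')
    (h1' : ∀ j, ι' j ≫ π' j = N' • 𝟙 (T j)) (h2' : ∀ j j', j ≠ j' → ι' j ≫ π' j' = 0)
    (h3' : ∑ j, π' j ≫ ι' j = N' • 𝟙 X')
    (hι' : ∀ j (g : G), ι' j ≫ End.asHom (ρ' g) = End.asHom (τ j g) ≫ ι' j)
    (hπ' : ∀ j (g : G), End.asHom (ρ' g) ≫ π' j = π' j ≫ End.asHom (τ j g))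
    {u : X ⟶ X'} (hu : IsIsogeny u) (hue : ∀ g : G, End.asHom (ρ g) ≫ u = u ≫ End.asHom (ρ' g))
    {B : AbelianVariety K} (β : G →* End B) (hB : 0 < B.dim)
    (hBs : ∀ (W : AbelianVariety K) (ω : G →* End W) (w : W ⟶ B),
      IsClosedImmersion (Hom.toSchemeHom w) →
      (∀ g : G, w ≫ End.asHom (β g) = End.asHom (ω g) ≫ w) → 0 < W.dim → W.dim < B.dim → False) :
    Nat.card {i // ∃ v : S i ⟶ B, IsIsogeny v ∧
        ∀ g : G, End.asHom (χ i g) ≫ v = v ≫ End.asHom (β g)} =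
      Nat.card {j // ∃ v : T j ⟶ B, IsIsogeny v ∧
        ∀ g : G, End.asHom (τ j g) ≫ v = v ≫ End.asHom (β g)} := by
  let ZG := MonoidAlgebra ℤ G
  let res : ∀ {A : AbelianVariety K}, (ZG →+* End A) → (G →* End A) :=
    fun φ ↦ (φ : ZG →* End _).comp (MonoidAlgebra.of ℤ G)
  let ext : ∀ {A : AbelianVariety K}, (G →* End A) → (ZG →+* End A) :=
    fun ρ ↦ (MonoidAlgebra.lift ℤ (End _) G ρ).toRingHom
  have ext_of : ∀ {A : AbelianVariety K} (ρ : G →* End A) (g : G),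
      ext ρ (MonoidAlgebra.of ℤ G g) = ρ g := fun ρ g ↦ by
    change MonoidAlgebra.lift ℤ (End _) G ρ (MonoidAlgebra.of ℤ G g) = ρ g
    exact MonoidAlgebra.lift_of ρ g
  have hin : ∀ {A B : AbelianVariety K} (a : G →* End A) (b : G →* End B) (f : A ⟶ B),
      (∀ g : G, f ≫ End.asHom (b g) = End.asHom (a g) ≫ f) →
      ∀ x : ZG, f ≫ End.asHom (ext b x) = End.asHom (ext a x) ≫ f :=
    fun a b f hf ↦ comp_eq_comp_monoidAlgebra_of_forall (ext a) (ext b) f fun g ↦ by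
      rw [ext_of, ext_of]; exact hf g
  have hsimple : ∀ {A : AbelianVariety K} (a : G →* End A),
      (∀ (W : AbelianVariety K) (ω : G →* End W) (w : W ⟶ A),
        IsClosedImmersion (Hom.toSchemeHom w) →
        (∀ g : G, w ≫ End.asHom (a g) = End.asHom (ω g) ≫ w) → 0 < W.dim → W.dim < A.dim →
        False) →
      ∀ (W : AbelianVariety K) (ω : ZG →+* End W) (w : W ⟶ A),
        IsClosedImmersion (Hom.toSchemeHom w) →
        (∀ x : ZG, w ≫ End.asHom (ext a x) = End.asHom (ω x) ≫ w) → 0 < W.dim → W.dim < A.dim →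
        False :=
    fun a ha W ω w hw hwe h0 hlt ↦ ha W (res ω) w hw (fun g ↦ by rw [← ext_of a g]; exact hwe _)
      h0 hlt
  -- `G`-equivariant isogenies to `B` and `ℤ[G]`-equivariant ones are the same
  have hiff : ∀ {A : AbelianVariety K} (a : G →* End A),
      (∃ v : A ⟶ B, IsIsogeny v ∧ ∀ g : G, End.asHom (a g) ≫ v = v ≫ End.asHom (β g)) ↔
      (∃ v : A ⟶ B, IsIsogeny v ∧
        ∀ x : ZG, End.asHom (ext a x) ≫ v = v ≫ End.asHom (ext β x)) := fun a ↦ by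
    refine ⟨fun ⟨v, hv, hve⟩ ↦ ⟨v, hv, fun x ↦ (hin a β v (fun g ↦ (hve g).symm) x).symm⟩,
      fun ⟨v, hv, hve⟩ ↦ ⟨v, hv, fun g ↦ ?_⟩⟩
    have e := hve (MonoidAlgebra.of ℤ G g)
    rwa [ext_of, ext_of] at e
  have hcard := card_equivariantlyIsogenous_eq_of_simpleFor ι π (ext ρ) (fun i ↦ ext (χ i))
    (fun i ↦ hsimple (χ i) (hS i)) hN h1 h2 h3
    (fun i x ↦ hin (χ i) ρ (ι i) (hι i) x)
    (fun i x ↦ (hin ρ (χ i) (π i) (fun g ↦ (hπ i g).symm) x).symm)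
    (ext ρ') (fun j ↦ ext (τ j)) (fun j ↦ hsimple (τ j) (hT j)) ι' π' hN' h1' h2' h3'
    (fun j x ↦ hin (τ j) ρ' (ι' j) (hι' j) x)
    (fun j x ↦ (hin ρ' (τ j) (π' j) (fun g ↦ (hπ' j g).symm) x).symm)
    hu (fun x ↦ (hin ρ ρ' u (fun g ↦ (hue g).symm) x).symm) (ext β) hB (hsimple β hBs)
  rw [Nat.card_congr (Equiv.subtypeEquivRight fun i ↦ hiff (χ i)),
    Nat.card_congr (Equiv.subtypeEquivRight fun j ↦ hiff (τ j))]
  exact hcard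

end AbelianVariety

end Literature.AlgebraicGeometry.Motives

end
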